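import Mathlib
import Summits.Ventures.PercRepro2.CoinTreeCore
import Summits.Ventures.PercRepro2.CoinOrTailKDefs
import Summits.Ventures.PercRepro2.CoinK2HeadAwareCoins

/-!
# Two incomparable uncovered entries, a HEAD-AWARE core and ARBITRARY coins: an instantiation
(blind cell PercRepro2, night-2 g13; NIGHT2-DARC.md §48.8)

A concrete coin system on `Fin 10` (s = 0, m₁ = 1, m₂ = 2, r₁ = 3, r₂ = 4, a = 5, w = 6, t = 7;
the vertices 8, 9 are unused — they serve as the virtual labels of the coin splitting): the four
branches `s → m₁`, `s → m₂`, `s → r₁`, `s → r₂` of an out-tree core, the two tail arcs `r₁ → a`,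
`r₂ → a` (coins 4 and 5, of ANY probability), the head coins `a → t`, `w → t`, `r₁ → t`, `r₂ → w`,
and — the head-aware part — the MARKER arcs `m₁ → t` and `m₂ → w` (coins 10, 11): the core
talks to the head through vertices that are not entries, which the head-blind theorem of g12
excluded.  `OrTailK` and `TreeCore` hold by `decide`; `darc_of_orTailTreeK2_coins` gives row 2′DARC
at `a → w` for the markers `m₁, m₂` and EVERY probability vector — no hypothesis at all.
-/

namespace Summit.Ventures.PercRepro2.Coin

namespace K2HeadAwareExample

open Classical

/-- The twelve coins of the example. -/
def arcsEx : Fin 12 → Finset (Fin 10 × Fin 10)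
  | 0 => {(0, 1)}   -- s → m₁
  | 1 => {(0, 2)}   -- s → m₂
  | 2 => {(0, 3)}   -- s → r₁
  | 3 => {(0, 4)}   -- s → r₂
  | 4 => {(3, 5)}   -- r₁ → a  (any probability)
  | 5 => {(4, 5)}   -- r₂ → a  (any probability)
  | 6 => {(5, 7)}   -- a → t
  | 7 => {(6, 7)}   -- w → t
  | 8 => {(3, 7)}   -- r₁ → t
  | 9 => {(4, 6)}   -- r₂ → w
  | 10 => {(1, 7)}  -- m₁ → t  (the head sees the marker m₁)
  | 11 => {(2, 6)}  -- m₂ → w  (the head sees the marker m₂)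

/-- The entry coins: `c r₁ = 4`, `c r₂ = 5`. -/
def cEx : Fin 10 → Fin 12
  | 3 => 4
  | 4 => 5
  | _ => 0

/-- The tree coins. -/
def tcEx : Fin 10 → Fin 12
  | 1 => 0
  | 2 => 1
  | 3 => 2
  | 4 => 3
  | _ => 0

/-- The parent map (every core vertex is a child of `s`). -/
def parEx : Fin 10 → Fin 10 := fun _ => 0

/-- The rank. -/
def rkEx : Fin 10 → ℕ
  | 1 => 1
  | 2 => 1
  | 3 => 1
  | 4 => 1
  | _ => 0

/-- Every coin is a single arc, so `SameEnds` holds. -/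
lemma sameEnds_ex : SameEnds arcsEx := by
  intro e xy hxy x'y' hx'y'
  fin_cases e <;> simp [arcsEx] at hxy hx'y' <;> subst hxy <;> subst hx'y' <;>
    exact ⟨Or.inl rfl, Or.inr rfl⟩

/-- `{m₁, m₂, r₁, r₂}` is an out-tree core of `s`. -/
lemma treeCore_ex : TreeCore arcsEx 0 {1, 2, 3, 4} tcEx parEx rkEx where
  tree := by decide
  par_mem := by decide
  rank := by decide
  into_C := by decide
  into_s := by decide
  s_notin := by decide

/-- The core with the tail `a = 5` entered from `r₁, r₂` is a two-entry OR-tail. -/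
lemma orTailK_ex : OrTailK arcsEx 0 {1, 2, 3, 4} {3, 4} cEx 5 where
  ent_sub := by decide
  s_notin := by decide
  a_notin := by decide
  a_ne_s := by decide
  into_U := by decide
  into_s := by decide
  into_a := by decide
  arcs_c := by decide
  c_inj := by decide

/-- **Row 2′DARC at the arc `a → w` for the markers `m₁, m₂`, with the two uncovered entries
`r₁, r₂` of incomparable traces, the markers' own arcs into the head, and EVERY probability
vector.** -/
theorem darc_k2HeadAware_example {R : Type*} [Field R] [LinearOrder R] [IsStrictOrderedRing R]
    (pr : Fin 12 → R) (hp : IsProbVec pr) :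
    DARC pr arcsEx 0 {7} 1 2 5 6 :=
  darc_of_orTailTreeK2_coins pr hp sameEnds_ex orTailK_ex treeCore_ex (by decide) (by decide)
    (r₁ := 3) (r₂ := 4) (r₁' := 8) (r₂' := 9) (by decide) (by decide) (by decide) (by decide)
    (by decide) (by decide) (by decide) (by decide) (by decide) (by decide) (by decide)
    (by decide) (by decide) (by decide) (by decide)

end K2HeadAwareExample

end Summit.Ventures.PercRepro2.Coin
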